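import Literature.Probability.FitznerVanDerHofstad2017.SrwTwistBesselRow
import Literature.Probability.FitznerVanDerHofstad2017.SrwLawBesselEGF
import Literature.Probability.FitznerVanDerHofstad2017.SrwTwistRowOrderBall
import Literature.Probability.LatticeModels.GinibreBesselBounds
import HarnessLib

/-!
# Inserted rows: the twisted one-coordinate transform with a trigonometric-polynomial weight

`SrwTwistBesselRow.lean` identifies the twisted one-coordinate transform
`B_m(v,y) = ∫_{[-π,π]} e^{v cos t + iy cos(mt)} dt` with the Bessel row `Σ_j I_{jm}(v)·2π i^{|j|} J_{|j|}(y)`.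
The WEIGHTED twisted moments of the K/U atoms (weights `|D̂|^l`, `|D̂|^l D̂^{sin}`, `M̂²`-insertions —
polynomials in the coordinate cosines and sines) need, coordinate by coordinate, the same transform with
a trigonometric polynomial `ω(t) = Σ_{r ∈ R} ω_r e^{irt}` INSERTED:

  `T^ω_m(v,y) = ∫_{[-π,π]} ω(t) e^{v cos t + iy cos(mt)} dt`.

Multiplying the generating function `e^{v cos t} = Σ_a I_a(v) e^{iat}` [DLMF 10.35.2] by `e^{irt}` only
SHIFTS the Bessel index, so `T^ω_m` is again a Bessel row with the SAME Fourier–Bessel coefficients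
`2π i^{|j|} J_{|j|}(y)` of the twist and the shifted I-weights `Σ_r ω_r I_{jm-r}(v)`:

* `hasSum_insertedChar_besselRow_μI` — one character: `∫ e^{irt} e^{v cos t + iy cos(mt)} dμI`
  `= Σ_{j ∈ ℤ} I_{jm-r}(v) · 2π i^{|j|} J_{|j|}(y)` (`m ≠ 0`, `r ∈ ℤ`; absolutely convergent);
* `hasSum_insertedRow_μI` — a trigonometric polynomial: `T^ω_m(v,y) = Σ_{j ∈ ℤ} (Σ_{r∈R} ω_r I_{jm-r}(v)) · 2π i^{|j|} J_{|j|}(y)`;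
* `hasSum_cos_besselRow_μI`, `hasSum_cos_sq_besselRow_μI` — the insertions that actually occur,
  `cos t ↦ ½(I_{jm-1} + I_{jm+1})` and `cos² t ↦ ¼(I_{jm-2} + 2 I_{jm} + I_{jm+2})`;
* `integral_exp_mul_cos_μI` (`∫ e^{v cos t} dμI = 2π I_0(v)`) and `norm_insertedRow_μI_le` — the
  unit-type anchor `‖T^ω_m(v,y)‖ ≤ (Σ_r ‖ω_r‖) · 2π I_0(v)` (`|e^{iy cos}| = |e^{irt}| = 1`), the input of
  truncation / perturbation budgets of the `SrwTwistTruncationSeeds` type for inserted rows;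
* `norm_insertedRow_add_sub_sum_range_le` — the two-sided ORDER BALL: truncating `T^ω_m` at twist
  order `|j| ≤ J` costs `4π (Σ_r ‖ω_r‖) I_{(J+1)|m|-ρ}(v) Σ_{l ≥ J+1} |J_l(y)|` whenever the inserted
  frequencies satisfy `|r| ≤ ρ ≤ (J+1)|m|` (generic two-sided tail lemma
  `norm_add_sub_sum_range_le_of_hasSum_int` + the index monotonicity of `I_a(v)`, `v ≥ 0`).

Everything is PROVED (standard axioms), d-free and table-free; no definition, no named fact.
Epistemic status / lane: what-if / input-certification SUPPORT (the analytic input of the weighted slices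
of a twisted-seed kernel certificate); nothing here is a certificate; no statement at a specific dimension.

## References
* NIST DLMF §10.35.2 (generating function of `I_n`), §10.12.2–10.12.3 (Jacobi–Anger), §10.9.2,
  §10.32.1. [DLMF]
* R. Fitzner, R. van der Hofstad, PTRF 169 (2017) 1041–1119, (3.34)–(3.36) p. 1071, §5.1.1 (5.2)–(5.5).
  [FitznerVanDerHofstad2016NoBLE]
* G. N. Watson, *A Treatise on the Theory of Bessel Functions* (1944), §2.22. [Watson1944]
-/

noncomputable section

open MeasureTheory Set Filter Real
open scoped Topology Nat

namespace Literature.Probability.FitznerVanDerHofstad2017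

open Literature.Barriers.CriticalPhenomena
open Literature.Barriers.CriticalPhenomena.Slade2006Prop53 (μI P)
open Literature.Probability.LatticeModels (besselI besselI_nonneg besselI_le_of_natAbs_le
  hasSum_besselI_mul_zpow summable_abs_besselI srwHeatKernel)
open Literature.Analysis.FunctionSpaces (besselJ)

/-- `|e^{iat}| = 1` for an integer frequency `a` (plumbing). [cite: DLMF, 10.35.2] -/
private theorem norm_cexp_intCast_mul' (a : ℤ) (t : ℝ) :
    ‖Complex.exp ((a : ℂ) * t * Complex.I)‖ = 1 := by
  rw [show (a : ℂ) * t * Complex.I = (((a : ℝ) * t : ℝ) : ℂ) * Complex.I by push_cast; ring]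
  exact Complex.norm_exp_ofReal_mul_I _

/-! ### One inserted character -/

/-- **Inserted character.** For `v y : ℝ`, an integer `m ≠ 0` and `r ∈ ℤ`,
`∫_{[-π,π]} e^{irt} e^{v cos t + iy cos(mt)} dt = Σ_{j ∈ ℤ} I_{jm-r}(v) · 2π i^{|j|} J_{|j|}(y)`:
termwise integration of `e^{irt} e^{v cos t} = Σ_a I_a(v) e^{i(a+r)t}` against the twist, whose Fourier
coefficients vanish off the multiples of `m` (`integral_cexp_int_mul_mul_cexp_cos_int_mul_μI`).
[cite: DLMF, 10.35.2; DLMF, 10.12.2; FitznerVanDerHofstad2016NoBLE, §5.1.1 (5.2)–(5.4)] -/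
theorem hasSum_insertedChar_besselRow_μI (v y : ℝ) {m : ℤ} (hm : m ≠ 0) (r : ℤ) :
    HasSum (fun j : ℤ => (besselI (j * m - r) v : ℂ)
        * (2 * π * Complex.I ^ j.natAbs * (besselJ j.natAbs y : ℂ)))
      (∫ t, Complex.exp ((r : ℂ) * t * Complex.I)
        * Complex.exp (((v * Real.cos t : ℝ) : ℂ) + ((y * Real.cos (m * t) : ℝ) : ℂ) * Complex.I) ∂μI) := by
  set E : ℝ → ℂ := fun t => Complex.exp (((y * Real.cos (m * t) : ℝ) : ℂ) * Complex.I) with hE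
  have hEc : Continuous E := by simp only [hE]; fun_prop
  have hEn : ∀ t, ‖E t‖ = 1 := fun t => by simp only [hE]; exact Complex.norm_exp_ofReal_mul_I _
  set F : ℤ → ℝ → ℂ := fun a t => (besselI a v : ℂ)
    * (Complex.exp (((a + r : ℤ) : ℂ) * t * Complex.I) * E t) with hF
  -- `e^{irt} e^{v cos t} e^{iy cos(mt)} = Σ_a I_a(v) e^{i(a+r)t} E(t)` pointwise
  have hgen : ∀ t : ℝ, HasSum (fun a : ℤ => F a t)
      (Complex.exp ((r : ℂ) * t * Complex.I)
        * Complex.exp (((v * Real.cos t : ℝ) : ℂ) + ((y * Real.cos (m * t) : ℝ) : ℂ) * Complex.I)) := by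
    intro t
    have h := ((hasSum_besselI_mul_zpow v (Circle.exp t)).mul_right (E t)).mul_left
      (Complex.exp ((r : ℂ) * t * Complex.I))
    have hz : ((Circle.exp t : Circle) : ℂ) = Complex.exp (t * Complex.I) := Circle.coe_exp t
    have hterm : (fun a : ℤ => Complex.exp ((r : ℂ) * t * Complex.I)
        * ((besselI a v : ℂ) * ((Circle.exp t : Circle) : ℂ) ^ a * E t)) = fun a => F a t := by
      funext a
      simp only [hF, hz, ← Complex.exp_int_mul]
      rw [show Complex.exp ((r : ℂ) * t * Complex.I) * ((besselI a v : ℂ)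
          * Complex.exp ((a : ℂ) * (t * Complex.I)) * E t)
          = (besselI a v : ℂ) * ((Complex.exp ((a : ℂ) * (t * Complex.I))
            * Complex.exp ((r : ℂ) * t * Complex.I)) * E t) by ring, ← Complex.exp_add]
      congr 3
      push_cast; ring
    have hval : Complex.exp ((r : ℂ) * t * Complex.I)
        * (((Real.exp (v * ((Circle.exp t : Circle) : ℂ).re) : ℝ) : ℂ) * E t)
        = Complex.exp ((r : ℂ) * t * Complex.I)
          * Complex.exp (((v * Real.cos t : ℝ) : ℂ) + ((y * Real.cos (m * t) : ℝ) : ℂ) * Complex.I) := by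
      rw [hz, Complex.exp_ofReal_mul_I_re, Complex.ofReal_exp, hE, ← Complex.exp_add]
    rw [hterm, hval] at h
    exact h
  -- dominated convergence (bound `|I_a(v)|`, summable, constant in `t`)
  have hsum : HasSum (fun a : ℤ => ∫ t, F a t ∂μI)
      (∫ t, Complex.exp ((r : ℂ) * t * Complex.I)
        * Complex.exp (((v * Real.cos t : ℝ) : ℂ) + ((y * Real.cos (m * t) : ℝ) : ℂ) * Complex.I) ∂μI) := by
    refine hasSum_integral_of_dominated_convergence (fun a _ => |besselI a v|) (fun a => ?_)
      (fun a => ae_of_all _ fun t => ?_) (ae_of_all _ fun _ => summable_abs_besselI v)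
      (integrable_const _) (ae_of_all _ fun t => hgen t)
    · exact Continuous.aestronglyMeasurable (by simp only [hF]; fun_prop)
    · simp only [hF]
      rw [norm_mul, norm_mul, hEn, norm_cexp_intCast_mul', mul_one, mul_one, Complex.norm_real,
        Real.norm_eq_abs]
  -- termwise: the Fourier coefficient of the twist at frequency `a + r`
  have hterm : ∀ a : ℤ, ∫ t, F a t ∂μI = (besselI a v : ℂ)
      * (if m ∣ (a + r) then 2 * π * Complex.I ^ ((a + r) / m).natAbs
          * (besselJ ((a + r) / m).natAbs y : ℂ) else 0) := by
    intro a
    simp only [hF]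
    rw [integral_const_mul, integral_cexp_int_mul_mul_cexp_cos_int_mul_μI y hm (a + r)]
  simp_rw [hterm] at hsum
  -- reindex along `a = j m - r`
  have hinj : Function.Injective (fun j : ℤ => j * m - r) := by
    intro j j' h
    exact mul_left_injective₀ hm (sub_left_injective h)
  have hzero : ∀ a ∉ Set.range (fun j : ℤ => j * m - r), (besselI a v : ℂ)
      * (if m ∣ (a + r) then 2 * π * Complex.I ^ ((a + r) / m).natAbs
          * (besselJ ((a + r) / m).natAbs y : ℂ) else 0) = 0 := by
    intro a ha
    have hna : ¬ m ∣ (a + r) := fun ⟨c, hc⟩ => ha ⟨c, by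
      show c * m - r = a
      rw [mul_comm, ← hc, add_sub_cancel_right]⟩
    rw [if_neg hna, mul_zero]
  have h := (hinj.hasSum_iff hzero).2 hsum
  have hfun : ((fun a : ℤ => (besselI a v : ℂ)
      * (if m ∣ (a + r) then 2 * π * Complex.I ^ ((a + r) / m).natAbs
          * (besselJ ((a + r) / m).natAbs y : ℂ) else 0))
        ∘ fun j : ℤ => j * m - r)
      = fun j : ℤ => (besselI (j * m - r) v : ℂ)
          * (2 * π * Complex.I ^ j.natAbs * (besselJ j.natAbs y : ℂ)) := by
    funext j
    simp only [Function.comp_apply, sub_add_cancel, if_pos (dvd_mul_left m j),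
      Int.mul_ediv_cancel j hm]
  rw [hfun] at h
  exact h

/-- Absolute convergence of the inserted-character row: `Σ_j |I_{jm-r}(v)|·2π|J_{|j|}(y)| < ∞`
(`|J_n| ≤ 1`, `Σ_a |I_a(v)| < ∞`). [cite: DLMF, 10.35.2; DLMF, 10.14.1] -/
theorem summable_norm_insertedChar_besselRow (v y : ℝ) {m : ℤ} (hm : m ≠ 0) (r : ℤ) :
    Summable fun j : ℤ => ‖(besselI (j * m - r) v : ℂ)
        * (2 * π * Complex.I ^ j.natAbs * (besselJ j.natAbs y : ℂ))‖ := by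
  have hinj : Function.Injective (fun j : ℤ => j * m - r) := by
    intro j j' h
    exact mul_left_injective₀ hm (sub_left_injective h)
  have h1 : Summable fun j : ℤ => |besselI (j * m - r) v| * (2 * π) :=
    ((summable_abs_besselI v).comp_injective hinj).mul_right _
  refine h1.of_nonneg_of_le (fun j => norm_nonneg _) (fun j => ?_)
  have hJ : |besselJ j.natAbs y| ≤ 1 := Literature.Analysis.FunctionSpaces.abs_besselJ_le_one_holds _ _
  rw [norm_mul, Complex.norm_real, Real.norm_eq_abs]
  refine mul_le_mul_of_nonneg_left ?_ (abs_nonneg _)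
  rw [norm_mul, norm_mul, norm_pow, Complex.norm_I, one_pow, mul_one, Complex.norm_real,
    Real.norm_eq_abs, norm_mul, Complex.norm_real, Real.norm_eq_abs, abs_of_pos Real.pi_pos,
    Complex.norm_ofNat]
  nlinarith [hJ, Real.pi_pos, abs_nonneg (besselJ j.natAbs y)]

/-! ### A trigonometric polynomial inserted -/

/-- **Inserted trigonometric polynomial.** For a finite set of frequencies `R ⊂ ℤ` and coefficients
`ω : ℤ → ℂ`, `∫_{[-π,π]} (Σ_{r∈R} ω_r e^{irt}) e^{v cos t + iy cos(mt)} dt`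
`= Σ_{j ∈ ℤ} (Σ_{r∈R} ω_r I_{jm-r}(v)) · 2π i^{|j|} J_{|j|}(y)` (`m ≠ 0`).
[cite: DLMF, 10.35.2; DLMF, 10.12.2; FitznerVanDerHofstad2016NoBLE, §5.1.1 (5.2)–(5.4)] -/
theorem hasSum_insertedRow_μI (v y : ℝ) {m : ℤ} (hm : m ≠ 0) (R : Finset ℤ) (ω : ℤ → ℂ) :
    HasSum (fun j : ℤ => (∑ r ∈ R, ω r * (besselI (j * m - r) v : ℂ))
        * (2 * π * Complex.I ^ j.natAbs * (besselJ j.natAbs y : ℂ)))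
      (∫ t, (∑ r ∈ R, ω r * Complex.exp ((r : ℂ) * t * Complex.I))
        * Complex.exp (((v * Real.cos t : ℝ) : ℂ) + ((y * Real.cos (m * t) : ℝ) : ℂ) * Complex.I) ∂μI) := by
  -- each character separately, then a finite sum (of integrals of integrable functions)
  have hint : ∀ r : ℤ, Integrable (fun t : ℝ => Complex.exp ((r : ℂ) * t * Complex.I)
      * Complex.exp (((v * Real.cos t : ℝ) : ℂ) + ((y * Real.cos (m * t) : ℝ) : ℂ) * Complex.I)) μI := by
    intro r
    have hc : Continuous (fun t : ℝ => Complex.exp ((r : ℂ) * t * Complex.I)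
        * Complex.exp (((v * Real.cos t : ℝ) : ℂ) + ((y * Real.cos (m * t) : ℝ) : ℂ) * Complex.I)) := by
      fun_prop
    exact hc.continuousOn.integrableOn_compact isCompact_Icc
  have h1 := hasSum_sum (s := R) (f := fun (r : ℤ) (j : ℤ) => ω r * ((besselI (j * m - r) v : ℂ)
      * (2 * π * Complex.I ^ j.natAbs * (besselJ j.natAbs y : ℂ))))
    (fun r _ => (hasSum_insertedChar_besselRow_μI v y hm r).mul_left (ω r))
  have hval : (∑ r ∈ R, ω r * ∫ t, Complex.exp ((r : ℂ) * t * Complex.I)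
        * Complex.exp (((v * Real.cos t : ℝ) : ℂ) + ((y * Real.cos (m * t) : ℝ) : ℂ) * Complex.I) ∂μI)
      = ∫ t, (∑ r ∈ R, ω r * Complex.exp ((r : ℂ) * t * Complex.I))
        * Complex.exp (((v * Real.cos t : ℝ) : ℂ) + ((y * Real.cos (m * t) : ℝ) : ℂ) * Complex.I) ∂μI := by
    simp_rw [← integral_const_mul]
    rw [← integral_finsetSum R (fun r _ => (hint r).const_mul (ω r))]
    refine integral_congr_ae (ae_of_all _ fun t => ?_)
    simp only [Finset.sum_mul, mul_assoc]
  rw [hval] at h1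
  refine h1.congr_fun fun j => ?_
  rw [Finset.sum_mul]
  refine Finset.sum_congr rfl fun r _ => ?_
  ring

/-! ### The insertions that occur: `cos t` and `cos² t` -/

/-- **`cos`-inserted row**: `∫_{[-π,π]} cos t · e^{v cos t + iy cos(mt)} dt`
`= Σ_{j ∈ ℤ} ½(I_{jm-1}(v) + I_{jm+1}(v)) · 2π i^{|j|} J_{|j|}(y)` (`m ≠ 0`; `cos t = ½(e^{it} + e^{-it})`,
i.e. the `v`-derivative row `I'_a = ½(I_{a-1} + I_{a+1})`).
[cite: DLMF, 10.35.2; DLMF, 10.29.1; FitznerVanDerHofstad2016NoBLE, §5.1.1 (5.2)–(5.4)] -/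
theorem hasSum_cos_besselRow_μI (v y : ℝ) {m : ℤ} (hm : m ≠ 0) :
    HasSum (fun j : ℤ => ((((besselI (j * m - 1) v + besselI (j * m + 1) v) / 2 : ℝ)) : ℂ)
        * (2 * π * Complex.I ^ j.natAbs * (besselJ j.natAbs y : ℂ)))
      (∫ t, ((Real.cos t : ℝ) : ℂ)
        * Complex.exp (((v * Real.cos t : ℝ) : ℂ) + ((y * Real.cos (m * t) : ℝ) : ℂ) * Complex.I) ∂μI) := by
  have h := hasSum_insertedRow_μI v y hm ({1, -1} : Finset ℤ) (fun _ => (1 / 2 : ℂ))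
  have hR : (1 : ℤ) ∉ ({-1} : Finset ℤ) := by decide
  have hcos : ∀ t : ℝ, (∑ r ∈ ({1, -1} : Finset ℤ), (1 / 2 : ℂ) * Complex.exp ((r : ℂ) * t * Complex.I))
      = ((Real.cos t : ℝ) : ℂ) := by
    intro t
    rw [Finset.sum_insert hR, Finset.sum_singleton, Complex.ofReal_cos, ← mul_add,
      show (Complex.cos t) = (Complex.exp (t * Complex.I) + Complex.exp (-t * Complex.I)) / 2 from by
        rw [← Complex.two_cos]; ring]
    push_cast
    ring_nf
  simp_rw [hcos] at h
  refine h.congr_fun fun j => ?_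
  rw [Finset.sum_insert hR, Finset.sum_singleton, sub_neg_eq_add]
  push_cast
  ring

/-- **`cos²`-inserted row**: `∫_{[-π,π]} cos² t · e^{v cos t + iy cos(mt)} dt`
`= Σ_{j ∈ ℤ} ¼(I_{jm-2}(v) + 2 I_{jm}(v) + I_{jm+2}(v)) · 2π i^{|j|} J_{|j|}(y)` (`m ≠ 0`;
`cos² t = ¼(e^{2it} + 2 + e^{-2it})`).
[cite: DLMF, 10.35.2; DLMF, 10.29.1; FitznerVanDerHofstad2016NoBLE, §5.1.1 (5.2)–(5.4)] -/
theorem hasSum_cos_sq_besselRow_μI (v y : ℝ) {m : ℤ} (hm : m ≠ 0) :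
    HasSum (fun j : ℤ =>
        ((((besselI (j * m - 2) v + 2 * besselI (j * m) v + besselI (j * m + 2) v) / 4 : ℝ)) : ℂ)
        * (2 * π * Complex.I ^ j.natAbs * (besselJ j.natAbs y : ℂ)))
      (∫ t, ((Real.cos t ^ 2 : ℝ) : ℂ)
        * Complex.exp (((v * Real.cos t : ℝ) : ℂ) + ((y * Real.cos (m * t) : ℝ) : ℂ) * Complex.I) ∂μI) := by
  set ω : ℤ → ℂ := fun r => if r = 0 then (1 / 2 : ℂ) else 1 / 4 with hω
  have h := hasSum_insertedRow_μI v y hm ({2, 0, -2} : Finset ℤ) ω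
  have hR2 : (2 : ℤ) ∉ ({0, -2} : Finset ℤ) := by decide
  have hR0 : (0 : ℤ) ∉ ({-2} : Finset ℤ) := by decide
  have hcos : ∀ t : ℝ, (∑ r ∈ ({2, 0, -2} : Finset ℤ), ω r * Complex.exp ((r : ℂ) * t * Complex.I))
      = ((Real.cos t ^ 2 : ℝ) : ℂ) := by
    intro t
    rw [Finset.sum_insert hR2, Finset.sum_insert hR0, Finset.sum_singleton]
    simp only [hω, if_true, show (2:ℤ) ≠ 0 by decide, show (-2:ℤ) ≠ 0 by decide, if_false]
    push_cast
    rw [show (Complex.cos t) = (Complex.exp (t * Complex.I)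
        + Complex.exp (-t * Complex.I)) / 2 from by rw [← Complex.two_cos]; ring]
    have e2 : Complex.exp (2 * (t : ℂ) * Complex.I) = Complex.exp (t * Complex.I) ^ 2 := by
      rw [← Complex.exp_nat_mul]; push_cast; ring_nf
    have e2' : Complex.exp (-2 * (t : ℂ) * Complex.I) = Complex.exp (-t * Complex.I) ^ 2 := by
      rw [← Complex.exp_nat_mul]; push_cast; ring_nf
    have e0 : Complex.exp (t * Complex.I) * Complex.exp (-t * Complex.I) = 1 := by
      rw [← Complex.exp_add]; ring_nf; exact Complex.exp_zero
    rw [e2, e2', zero_mul, zero_mul, Complex.exp_zero]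
    linear_combination (-(1:ℂ) / 2) * e0
  simp_rw [hcos] at h
  refine h.congr_fun fun j => ?_
  rw [Finset.sum_insert hR2, Finset.sum_insert hR0, Finset.sum_singleton]
  simp only [hω, if_true, show (2:ℤ) ≠ 0 by decide, show (-2:ℤ) ≠ 0 by decide, if_false, sub_zero,
    sub_neg_eq_add]
  push_cast
  ring

/-! ### The unit-type anchor for inserted rows -/

/-- `∫_{[-π,π]} e^{v cos t} dt = 2π I_0(v)` (the untwisted transform; `q_v(0) = e^{-v} I_0(v)`).
[cite: DLMF, 10.32.1] -/
theorem integral_exp_mul_cos_μI (v : ℝ) : ∫ t, Real.exp (v * Real.cos t) ∂μI = 2 * π * besselI 0 v := by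
  rw [show μI = volume.restrict (Icc (-π) π) from rfl, integral_Icc_eq_integral_Ioc,
    ← intervalIntegral.integral_of_le (by linarith [Real.pi_pos] : -π ≤ π)]
  have hq : 2 * π * srwHeatKernel v 0 = ∫ k in (-π)..π, Real.exp (-(v * (1 - Real.cos k))) := by
    simp only [srwHeatKernel, Int.cast_zero, mul_zero, Real.cos_zero, one_mul]
    field_simp
  have e1 : ∀ k : ℝ, Real.exp (v * Real.cos k) = Real.exp v * Real.exp (-(v * (1 - Real.cos k))) := by
    intro k
    rw [← Real.exp_add]
    congr 1; ring
  have e2 : Real.exp v * Real.exp (-v) = 1 := by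
    rw [← Real.exp_add, add_neg_cancel, Real.exp_zero]
  simp_rw [e1]
  rw [intervalIntegral.integral_const_mul, ← hq, srwHeatKernel_eq_exp_neg_mul_besselI]
  calc Real.exp v * (2 * π * (Real.exp (-v) * besselI 0 v))
      = 2 * π * (Real.exp v * Real.exp (-v)) * besselI 0 v := by ring
    _ = 2 * π * besselI 0 v := by rw [e2, mul_one]

/-- **`‖T^ω_m(v,y)‖ ≤ (Σ_r ‖ω_r‖) · 2π I_0(v)`**: an inserted row is bounded by the coefficient 1-norm
of the inserted trigonometric polynomial times the untwisted transform (`|e^{irt}| = |e^{iy cos}| = 1`).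
[cite: DLMF, 10.32.1; FitznerVanDerHofstad2016NoBLE, §5.1.1 (5.2)–(5.4)] -/
theorem norm_insertedRow_μI_le (v y : ℝ) (m : ℤ) (R : Finset ℤ) (ω : ℤ → ℂ) :
    ‖∫ t, (∑ r ∈ R, ω r * Complex.exp ((r : ℂ) * t * Complex.I))
        * Complex.exp (((v * Real.cos t : ℝ) : ℂ) + ((y * Real.cos (m * t) : ℝ) : ℂ) * Complex.I) ∂μI‖
      ≤ (∑ r ∈ R, ‖ω r‖) * (2 * π * besselI 0 v) := by
  have hE : ∀ t : ℝ, ‖Complex.exp (((v * Real.cos t : ℝ) : ℂ)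
      + ((y * Real.cos (m * t) : ℝ) : ℂ) * Complex.I)‖ = Real.exp (v * Real.cos t) := by
    intro t
    rw [Complex.norm_exp, Complex.add_re, Complex.ofReal_re, Complex.mul_I_re, Complex.ofReal_im,
      neg_zero, add_zero]
  have hω : ∀ t : ℝ, ‖∑ r ∈ R, ω r * Complex.exp ((r : ℂ) * t * Complex.I)‖ ≤ ∑ r ∈ R, ‖ω r‖ := by
    intro t
    refine (norm_sum_le _ _).trans (Finset.sum_le_sum fun r _ => ?_)
    rw [norm_mul, norm_cexp_intCast_mul', mul_one]
  have hptw : ∀ t : ℝ, ‖(∑ r ∈ R, ω r * Complex.exp ((r : ℂ) * t * Complex.I))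
      * Complex.exp (((v * Real.cos t : ℝ) : ℂ) + ((y * Real.cos (m * t) : ℝ) : ℂ) * Complex.I)‖
      ≤ (∑ r ∈ R, ‖ω r‖) * Real.exp (v * Real.cos t) := by
    intro t
    rw [norm_mul, hE]
    exact mul_le_mul_of_nonneg_right (hω t) (Real.exp_pos _).le
  have hint : Integrable (fun t : ℝ => (∑ r ∈ R, ‖ω r‖) * Real.exp (v * Real.cos t)) μI := by
    have hc : Continuous (fun t : ℝ => (∑ r ∈ R, ‖ω r‖) * Real.exp (v * Real.cos t)) := by fun_prop
    exact hc.continuousOn.integrableOn_compact isCompact_Icc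
  calc ‖∫ t, (∑ r ∈ R, ω r * Complex.exp ((r : ℂ) * t * Complex.I))
        * Complex.exp (((v * Real.cos t : ℝ) : ℂ) + ((y * Real.cos (m * t) : ℝ) : ℂ) * Complex.I) ∂μI‖
      ≤ ∫ t, (∑ r ∈ R, ‖ω r‖) * Real.exp (v * Real.cos t) ∂μI :=
        norm_integral_le_of_norm_le hint (ae_of_all _ hptw)
    _ = (∑ r ∈ R, ‖ω r‖) * (2 * π * besselI 0 v) := by
        rw [integral_const_mul, integral_exp_mul_cos_μI]

/-! ### Truncation of an inserted row (two-sided order ball) -/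

/-- **Two-sided tail of a row dominated by Bessel-`J` moduli.** If `Σ_{j ∈ ℤ} g_j = T` and
`‖g_j‖ ≤ C |J_{|j|}(y)|` for `|j| ≥ J + 1`, then the folded truncation error obeys
`‖T + g_0 − Σ_{n ≤ J} (g_n + g_{-n})‖ ≤ 2C Σ_{l ≥ J+1} |J_l(y)|`.
[cite: DLMF, 10.14.4; Watson1944, §2.22] -/
theorem norm_add_sub_sum_range_le_of_hasSum_int (y : ℝ) {g : ℤ → ℂ} {T : ℂ} (hg : HasSum g T)
    (J : ℕ) {C : ℝ} (hb : ∀ j : ℤ, J + 1 ≤ j.natAbs → ‖g j‖ ≤ C * |besselJ j.natAbs y|) :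
    ‖T + g 0 - ∑ n ∈ Finset.range (J + 1), (g n + g (-(n : ℤ)))‖
      ≤ 2 * C * ∑' l : ℕ, |besselJ (l + J + 1) y| := by
  have h1 : HasSum (fun n : ℕ => g n + g (-(n : ℤ))) (T + g 0) := hg.nat_add_neg
  have h2 := (hasSum_nat_add_iff' (J + 1)).2 h1
  rw [← h2.tsum_eq]
  have hbd : ∀ n : ℕ, ‖g ((n + (J + 1) : ℕ) : ℤ) + g (-((n + (J + 1) : ℕ) : ℤ))‖
      ≤ 2 * C * |besselJ (n + J + 1) y| := by
    intro n
    have e1 := hb ((n + (J + 1) : ℕ) : ℤ) (by rw [Int.natAbs_natCast]; omega)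
    have e2 := hb (-((n + (J + 1) : ℕ) : ℤ)) (by rw [Int.natAbs_neg, Int.natAbs_natCast]; omega)
    simp only [Int.natAbs_neg, Int.natAbs_natCast] at e1 e2
    rw [show n + J + 1 = n + (J + 1) by ring]
    exact (norm_add_le _ _).trans (by linarith)
  have hs : Summable (fun n : ℕ => 2 * C * |besselJ (n + J + 1) y|) :=
    (summable_abs_besselJ_tail J y).mul_left _
  have hs' : Summable (fun n : ℕ => ‖g ((n + (J + 1) : ℕ) : ℤ) + g (-((n + (J + 1) : ℕ) : ℤ))‖) :=
    hs.of_nonneg_of_le (fun _ => norm_nonneg _) hbd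
  calc ‖∑' n : ℕ, (g ((n + (J + 1) : ℕ) : ℤ) + g (-((n + (J + 1) : ℕ) : ℤ)))‖
      ≤ ∑' n : ℕ, ‖g ((n + (J + 1) : ℕ) : ℤ) + g (-((n + (J + 1) : ℕ) : ℤ))‖ := norm_tsum_le_tsum_norm hs'
    _ ≤ ∑' n : ℕ, 2 * C * |besselJ (n + J + 1) y| := hs'.tsum_le_tsum hbd hs
    _ = 2 * C * ∑' l : ℕ, |besselJ (l + J + 1) y| := tsum_mul_left

/-- The shifted I-weight of an inserted row off the truncation window: for `v ≥ 0`, `|r| ≤ ρ` on `R`,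
`ρ ≤ (J+1)|m|` and `|j| ≥ J + 1`, `‖Σ_{r∈R} ω_r I_{jm-r}(v)‖ ≤ (Σ_r ‖ω_r‖) I_{(J+1)|m|-ρ}(v)`
(`I_a(v)` is non-increasing in `|a|`, and `|jm - r| ≥ (J+1)|m| - ρ`). [cite: Watson1944, §3.71] -/
theorem norm_insertedWeight_le {v : ℝ} (hv : 0 ≤ v) (m : ℤ) (R : Finset ℤ) (ω : ℤ → ℂ) {J ρ : ℕ}
    (hρ : ∀ r ∈ R, r.natAbs ≤ ρ) (hJ : ρ ≤ (J + 1) * m.natAbs) {j : ℤ} (hj : J + 1 ≤ j.natAbs) :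
    ‖∑ r ∈ R, ω r * (besselI (j * m - r) v : ℂ)‖
      ≤ (∑ r ∈ R, ‖ω r‖) * besselI ((((J + 1) * m.natAbs - ρ : ℕ)) : ℤ) v := by
  rw [Finset.sum_mul]
  refine (norm_sum_le _ _).trans (Finset.sum_le_sum fun r hr => ?_)
  rw [norm_mul, Complex.norm_real, Real.norm_eq_abs, abs_of_nonneg (besselI_nonneg hv _)]
  refine mul_le_mul_of_nonneg_left (besselI_le_of_natAbs_le hv ?_) (norm_nonneg _)
  have h1 : (j * m).natAbs ≤ (j * m - r).natAbs + r.natAbs := by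
    have := Int.natAbs_add_le (j * m - r) r
    rwa [sub_add_cancel] at this
  have h2 : (J + 1) * m.natAbs ≤ (j * m).natAbs := by
    rw [Int.natAbs_mul]; exact Nat.mul_le_mul_right _ hj
  have h3 := hρ r hr
  simp only [Int.natAbs_natCast]
  omega

/-- **Two-sided order ball for an inserted row.** With `W_j = Σ_{r∈R} ω_r I_{jm-r}(v)` and
`F_j = 2π i^{|j|} J_{|j|}(y)`, for `v ≥ 0`, `m ≠ 0`, `|r| ≤ ρ ≤ (J+1)|m|` on `R`:
`‖T^ω_m(v,y) + W_0 F_0 − Σ_{n ≤ J} (W_n F_n + W_{-n} F_{-n})‖`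
`≤ 4π (Σ_r ‖ω_r‖) I_{(J+1)|m|-ρ}(v) Σ_{l ≥ J+1} |J_l(y)|` — truncating an inserted row at twist order
`J` costs the 1-norm of the insertion times ONE shifted plain Bessel weight times the `J`-tail.
[cite: DLMF, 10.35.2; DLMF, 10.14.4; Watson1944, §3.71; FitznerVanDerHofstad2016NoBLE, §5.1.1 (5.2)–(5.4)] -/
theorem norm_insertedRow_add_sub_sum_range_le {v : ℝ} (hv : 0 ≤ v) (y : ℝ) {m : ℤ} (hm : m ≠ 0)
    (R : Finset ℤ) (ω : ℤ → ℂ) {J ρ : ℕ} (hρ : ∀ r ∈ R, r.natAbs ≤ ρ) (hJ : ρ ≤ (J + 1) * m.natAbs) :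
    ‖(∫ t, (∑ r ∈ R, ω r * Complex.exp ((r : ℂ) * t * Complex.I))
        * Complex.exp (((v * Real.cos t : ℝ) : ℂ) + ((y * Real.cos (m * t) : ℝ) : ℂ) * Complex.I) ∂μI)
      + (∑ r ∈ R, ω r * (besselI (0 * m - r) v : ℂ))
          * (2 * π * Complex.I ^ (0 : ℤ).natAbs * (besselJ (0 : ℤ).natAbs y : ℂ))
      - ∑ n ∈ Finset.range (J + 1),
          ((∑ r ∈ R, ω r * (besselI (n * m - r) v : ℂ))
              * (2 * π * Complex.I ^ (n : ℤ).natAbs * (besselJ (n : ℤ).natAbs y : ℂ))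
            + (∑ r ∈ R, ω r * (besselI (-(n : ℤ) * m - r) v : ℂ))
              * (2 * π * Complex.I ^ (-(n : ℤ)).natAbs * (besselJ (-(n : ℤ)).natAbs y : ℂ)))‖
      ≤ 4 * π * (∑ r ∈ R, ‖ω r‖) * besselI ((((J + 1) * m.natAbs - ρ : ℕ)) : ℤ) v
          * ∑' l : ℕ, |besselJ (l + J + 1) y| := by
  have h := norm_add_sub_sum_range_le_of_hasSum_int y (hasSum_insertedRow_μI v y hm R ω) J
    (C := 2 * π * ((∑ r ∈ R, ‖ω r‖) * besselI ((((J + 1) * m.natAbs - ρ : ℕ)) : ℤ) v)) ?_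
  · beta_reduce at h
    refine h.trans_eq ?_
    ring
  · intro j hj
    rw [norm_mul, show ‖(2 * π * Complex.I ^ j.natAbs * (besselJ j.natAbs y : ℂ))‖
        = 2 * π * |besselJ j.natAbs y| by
      rw [norm_mul, norm_mul, norm_pow, Complex.norm_I, one_pow, mul_one, Complex.norm_real,
        Real.norm_eq_abs, norm_mul, Complex.norm_real, Real.norm_eq_abs, abs_of_pos Real.pi_pos,
        Complex.norm_ofNat]]
    have hW := norm_insertedWeight_le hv m R ω hρ hJ hj
    have hJn : 0 ≤ |besselJ j.natAbs y| := abs_nonneg _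
    calc ‖∑ r ∈ R, ω r * (besselI (j * m - r) v : ℂ)‖ * (2 * π * |besselJ j.natAbs y|)
        ≤ ((∑ r ∈ R, ‖ω r‖) * besselI ((((J + 1) * m.natAbs - ρ : ℕ)) : ℤ) v)
            * (2 * π * |besselJ j.natAbs y|) :=
          mul_le_mul_of_nonneg_right hW (by positivity)
      _ = 2 * π * ((∑ r ∈ R, ‖ω r‖) * besselI ((((J + 1) * m.natAbs - ρ : ℕ)) : ℤ) v)
            * |besselJ j.natAbs y| := by ring

end Literature.Probability.FitznerVanDerHofstad2017
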